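import Summits.SmoothPoincare4.SmoothPoincare4.Theorems.EntropyRungNoncompactShrinkerGapTransplantJacobian
import Summits.SmoothPoincare4.SmoothPoincare4.Theorems.EntropyRungNoncompactShrinkerGapTransplantSourceChart
import Mathlib.MeasureTheory.Function.Jacobian

/-!
# Transplant comparison, IV: `(1-η)² (V_h ⊗ dt)(S) ≤ Vol_g(Φ S) ≤ (1+η)² (V_h ⊗ dt)(S)`

Helper file of the stub `stub_transplantComparison` (U3) of line `collapsed-ends-usc`, crux
`EntropyRung.NoncompactShrinkerGap` (stmt-SmoothPoincare4-10868): the fact-free change of variables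
under a `(1 ± η)`-transplant `N × ℝ → M` (see
`EntropyRungNoncompactShrinkerGapStubTransplantComparison.lean` for the statement and the plan).

This file: the **two-sided comparison of `Vol_g ∘ Φ` with `dV_h ⊗ dt`** for measurable `S ⊆ U`
under an `η`-transplant (`volume_image_le_and_le_local`: one chart of `N` and one chart of `M`,
via `prod_apply_eq_lintegral_chart`, the chart formula `riemannianMeasure_eq_integral_sqrt_det_holds`,
Mathlib's Euclidean change of variables `lintegral_image_eq_lintegral_abs_det_fderiv_mul` for the
injective differentiable `φ_M ∘ Φ ∘ (φ_N⁻¹ × id) ∘ L⁻¹` and `jacobian_mul_density_bounds`;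
`volume_image_le_and_le`: countable atlases, disjointification, countable additivity), and its
integral form for nonnegative measurable functions (`lintegral_comp_le_and_le`: the push-forward of
`Vol_g|_{Φ U}` under `Ψ` is squeezed between `(1∓η)² (V_h ⊗ dt)|_U`).

## References

* H. Federer, *Geometric Measure Theory*, Springer 1969, §3.2.3 (area formula), §3.2.46
  (Hausdorff measure of a Riemannian manifold). [Federer1969]
* I. Chavel, *Riemannian Geometry: A Modern Introduction*, 2nd ed., CUP 2006, §III.3, (III.3.6)
  (integration in local coordinates). [Chavel2006]
-/

noncomputable section

-- the prescribed namespace `Summit.<Summit>.<Problem>.…` repeats `SmoothPoincare4` (summit = problem)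
set_option linter.dupNamespace false

namespace Summit.SmoothPoincare4.SmoothPoincare4.Theorems.NoncompactShrinkerGapTransplantComparison

open scoped Manifold ContDiff ENNReal NNReal Topology Bundle
open MeasureTheory Set
open Literature.Geometry.Lorentzian Literature.Geometry.Riemannian


/-! ### Two-sided comparison of `Vol_g ∘ Φ` with `dV_h ⊗ dt` -/

section VolumeComparison

variable {M : Type*} [TopologicalSpace M] [T2Space M] [ChartedSpace E4 M] [IsManifold (𝓡 4) ∞ M]
  [T3Space M] [MeasurableSpace M] [BorelSpace M]
  {N : Type*} [TopologicalSpace N] [ChartedSpace E3 N] [IsManifold (𝓡 3) ∞ N]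
  [T3Space N] [MeasurableSpace N] [BorelSpace N]

omit [TopologicalSpace M] [T2Space M] [ChartedSpace E4 M] [IsManifold (𝓡 4) ∞ M] [T3Space M]
  [MeasurableSpace M] [BorelSpace M] [TopologicalSpace N] [ChartedSpace E3 N]
  [IsManifold (𝓡 3) ∞ N] [T3Space N] [MeasurableSpace N] [BorelSpace N] in
/-- With a left inverse `Ψ` of `Φ` on `U`, images of subsets of `U` are preimages:
`Φ S = Φ U ∩ Ψ⁻¹ S`. [folklore] -/
theorem image_eq_inter_preimage {U S : Set (N × ℝ)} {Φ : N × ℝ → M} {Ψ : M → N × ℝ}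
    (hinv : ∀ p ∈ U, Ψ (Φ p) = p) (hSU : S ⊆ U) : Φ '' S = (Φ '' U) ∩ Ψ ⁻¹' S := by
  ext x
  constructor
  · rintro ⟨p, hp, rfl⟩
    exact ⟨mem_image_of_mem Φ (hSU hp), by rw [mem_preimage, hinv p (hSU hp)]; exact hp⟩
  · rintro ⟨⟨p, hp, rfl⟩, hx⟩
    rw [mem_preimage, hinv p hp] at hx
    exact ⟨p, hx, rfl⟩

/-- **The comparison for a measurable piece read in one chart of `N` and one chart of `M`.**
Let `g` be Riemannian on `M⁴`, `h` Riemannian on `N³`, `Φ` smooth on the open `U ⊆ N × ℝ` with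
open image and a continuous left inverse `Ψ` on `Φ U`, and
`(1-η)(h(v,v) + s²) ≤ g(dΦ(v,s), dΦ(v,s)) ≤ (1+η)(h(v,v) + s²)` on `U` (`0 ≤ η < 1`). If
`S ⊆ U` is measurable, lies over the domain of the chart of `N` at `q₀` and is mapped by `Φ` into
the domain of the chart of `M` at `p₀`, then
`(1-η)² (V_h ⊗ dt)(S) ≤ Vol_g(Φ S) ≤ (1+η)² (V_h ⊗ dt)(S)`. Proof: `(V_h ⊗ dt)(S) = ∫_{S'} √det h`
over the chart image `S' ⊆ ℝ³ × ℝ` (`prod_apply_eq_lintegral_chart`), `Vol_g(Φ S) = ∫ √det g`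
over `φ_M(Φ S) = f(L S')` with `f = φ_M ∘ Φ ∘ (φ_N⁻¹ × id) ∘ L⁻¹` injective and differentiable
(`riemannianMeasure_eq_integral_sqrt_det_holds`), Euclidean change of variables
(`lintegral_image_eq_lintegral_abs_det_fderiv_mul`) and the pointwise bounds
`jacobian_mul_density_bounds`; `L : ℝ³ × ℝ ≅ ℝ⁴` is measure preserving. Federer 1969, §3.2.3.
[cite: Federer1969, §3.2.3] -/
theorem volume_image_le_and_le_local
    (g : PseudoRiemannianMetric (𝓡 4) ∞ E4 (TangentSpace (𝓡 4) : M → Type _))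
    (hg : g.IsRiemannian)
    (h : PseudoRiemannianMetric (𝓡 3) ∞ E3 (TangentSpace (𝓡 3) : N → Type _))
    (hh : h.IsRiemannian) {U : Set (N × ℝ)} {Φ : N × ℝ → M} {Ψ : M → N × ℝ} {η : ℝ}
    (h0 : 0 ≤ η) (hη : η < 1) (hU : IsOpen U) (hΦ : ContMDiffOn ((𝓡 3).prod 𝓘(ℝ, ℝ)) (𝓡 4) ∞ Φ U)
    (hΦU : IsOpen (Φ '' U)) (hΨ : ContinuousOn Ψ (Φ '' U)) (hinv : ∀ p ∈ U, Ψ (Φ p) = p)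
    (hD : ∀ p ∈ U, ∀ (v : E3) (s : ℝ), (1 - η) * (h.val p.1 v v + s ^ 2) ≤
        g.val (Φ p) (mfderiv ((𝓡 3).prod 𝓘(ℝ, ℝ)) (𝓡 4) Φ p (v, s))
          (mfderiv ((𝓡 3).prod 𝓘(ℝ, ℝ)) (𝓡 4) Φ p (v, s)) ∧
        g.val (Φ p) (mfderiv ((𝓡 3).prod 𝓘(ℝ, ℝ)) (𝓡 4) Φ p (v, s))
          (mfderiv ((𝓡 3).prod 𝓘(ℝ, ℝ)) (𝓡 4) Φ p (v, s)) ≤ (1 + η) * (h.val p.1 v v + s ^ 2))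
    (q₀ : N) (p₀ : M) {S : Set (N × ℝ)} (hSU : S ⊆ U) (hS : MeasurableSet S)
    (hSq : S ⊆ (extChartAt (𝓡 3) q₀).source ×ˢ (univ : Set ℝ))
    (hSp : MapsTo Φ S (chartAt E4 p₀).source) :
    ENNReal.ofReal ((1 - η) ^ 2) * (h.riemVolume.prod volume) S ≤ g.riemVolume (Φ '' S) ∧
      g.riemVolume (Φ '' S) ≤ ENNReal.ofReal ((1 + η) ^ 2) * (h.riemVolume.prod volume) S := by
  obtain ⟨L, hL, hLmp⟩ := exists_prodEquiv
  set φN := extChartAt (𝓡 3) q₀ with hφN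
  set φM := extChartAt (𝓡 4) p₀ with hφM
  set eN : E3 × ℝ → N × ℝ := fun q ↦ (φN.symm q.1, q.2) with heN
  set S' : Set (E3 × ℝ) := (φN.target ×ˢ (univ : Set ℝ)) ∩ eN ⁻¹' S with hS'_def
  set ρh : E3 → ℝ := fun z ↦
    Real.sqrt (chartGramMatrix (h.toContMDiffRiemannianMetric hh) q₀ z).det with hρh
  set ρg : E4 → ℝ≥0∞ := fun z ↦
    ENNReal.ofReal (Real.sqrt (chartGramMatrix (g.toContMDiffRiemannianMetric hg) p₀ z).det) with hρg
  set f : E4 → E4 := (φM ∘ Φ ∘ eN) ∘ L.symm with hf_def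
  set f' : E4 → (E4 →L[ℝ] E4) := fun x ↦
    (fderiv ℝ (φM ∘ Φ ∘ eN) (L.symm x)).comp (L.symm : E4 →L[ℝ] E3 × ℝ) with hf'_def
  -- (1) the source side in the chart of `N`
  have h1 : (h.riemVolume.prod volume) S = ∫⁻ q in S', ENNReal.ofReal (ρh q.1) := by
    rw [PseudoRiemannianMetric.riemVolume_eq hh]
    exact prod_apply_eq_lintegral_chart _ q₀ hS hSq
  -- (2) the target side in the chart of `M`
  have hmS : MeasurableSet (Φ '' S) := by
    rw [image_eq_inter_preimage hinv hSU]
    exact measurableSet_inter_preimage_of_continuousOn hΨ hΦU.measurableSet hS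
  have hsrcS : Φ '' S ⊆ φM.source := by
    rw [hφM, extChartAt_source]; exact hSp.image_subset
  have h3 : g.riemVolume (Φ '' S) = ∫⁻ z in φM '' (Φ '' S), ρg z := by
    rw [PseudoRiemannianMetric.riemVolume_eq hg]
    exact riemannianMeasure_eq_integral_sqrt_det_holds _ p₀ hmS hsrcS
  -- (3) `eN S' = S` and `φ_M (Φ S) = f (L S')`
  have heS : eN '' S' = S := by
    apply Subset.antisymm
    · rintro _ ⟨q, hq, rfl⟩; exact hq.2
    · intro p hp
      have hp1 : p.1 ∈ φN.source := (hSq hp).1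
      have hep : eN (φN p.1, p.2) = p := by
        simp only [heN, φN.left_inv hp1]
      exact ⟨(φN p.1, p.2), ⟨⟨φN.map_source hp1, mem_univ _⟩, by rw [mem_preimage, hep]; exact hp⟩,
        hep⟩
  have himg : φM '' (Φ '' S) = f '' (L '' S') := by
    rw [← heS, image_image, image_image, image_image]
    refine image_congr fun q _ ↦ ?_
    change φM (Φ (eN q)) = (φM ∘ Φ ∘ eN) (L.symm (L q))
    rw [L.symm_apply_apply]; rfl
  -- (4) Euclidean change of variables for `f` on `L S'`
  have hmS' : MeasurableSet S' :=
    measurableSet_inter_preimage_of_continuousOn (continuousOn_chartSymm_prod q₀)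
      ((measurableSet_extChartAt_target (I := 𝓡 3) q₀).prod MeasurableSet.univ) hS
  have hemb : MeasurableEmbedding L := L.toHomeomorph.measurableEmbedding
  have hmLS' : MeasurableSet (L '' S') := hemb.measurableSet_image.2 hmS'
  have hderiv : ∀ x ∈ L '' S', HasFDerivWithinAt f (f' x) (L '' S') x := by
    rintro _ ⟨q, hq, rfl⟩
    obtain ⟨hfd, -⟩ := jacobian_mul_density_bounds g hg h hh h0 hη hU hΦ hD L hL q₀ p₀ hq.1.1
      (hSU hq.2) (hSp hq.2)
    have h1 : HasFDerivAt (φM ∘ Φ ∘ eN) (fderiv ℝ (φM ∘ Φ ∘ eN) q) (L.symm (L q)) := by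
      rw [L.symm_apply_apply]; exact hfd.hasFDerivAt
    have h2 : HasFDerivAt f ((fderiv ℝ (φM ∘ Φ ∘ eN) q).comp (L.symm : E4 →L[ℝ] E3 × ℝ)) (L q) :=
      h1.comp (L q) L.symm.hasFDerivAt
    have h3 : f' (L q) = (fderiv ℝ (φM ∘ Φ ∘ eN) q).comp (L.symm : E4 →L[ℝ] E3 × ℝ) := by
      simp only [hf'_def, L.symm_apply_apply]
    rw [h3]
    exact h2.hasFDerivWithinAt
  have hinjΦ : InjOn Φ U := fun p hp p' hp' he ↦ by rw [← hinv p hp, ← hinv p' hp', he]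
  have hinj : InjOn f (L '' S') := by
    rintro _ ⟨q, hq, rfl⟩ _ ⟨q', hq', rfl⟩ he
    have he' : φM (Φ (eN q)) = φM (Φ (eN q')) := by
      simpa only [hf_def, Function.comp_apply, L.symm_apply_apply] using he
    have h1 : Φ (eN q) = Φ (eN q') :=
      φM.injOn (hsrcS (mem_image_of_mem Φ hq.2)) (hsrcS (mem_image_of_mem Φ hq'.2)) he'
    have h2 : eN q = eN q' := hinjΦ (hSU hq.2) (hSU hq'.2) h1
    have hq1 : (eN q).1 = (eN q').1 := congrArg Prod.fst h2
    have hq2 : (eN q).2 = (eN q').2 := congrArg Prod.snd h2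
    have h3 : q = q' := Prod.ext (φN.symm.injOn hq.1.1 hq'.1.1 hq1) hq2
    rw [h3]
  have h5 := lintegral_image_eq_lintegral_abs_det_fderiv_mul volume hmLS' hderiv hinj ρg
  -- (5) pointwise bounds and the measure preserving identification
  have hbound : ∀ x ∈ L '' S',
      ENNReal.ofReal ((1 - η) ^ 2) * ENNReal.ofReal (ρh (L.symm x).1) ≤
        ENNReal.ofReal |(f' x).det| * ρg (f x) ∧
      ENNReal.ofReal |(f' x).det| * ρg (f x) ≤
        ENNReal.ofReal ((1 + η) ^ 2) * ENNReal.ofReal (ρh (L.symm x).1) := by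
    rintro _ ⟨q, hq, rfl⟩
    obtain ⟨-, hlo, hhi⟩ := jacobian_mul_density_bounds g hg h hh h0 hη hU hΦ hD L hL q₀ p₀ hq.1.1
      (hSU hq.2) (hSp hq.2)
    simp only [hf_def, hf'_def, hρg, hρh, Function.comp_apply, L.symm_apply_apply]
    rw [← ENNReal.ofReal_mul (abs_nonneg _), ← ENNReal.ofReal_mul (sq_nonneg _),
      ← ENNReal.ofReal_mul (sq_nonneg _)]
    exact ⟨ENNReal.ofReal_le_ofReal hlo, ENNReal.ofReal_le_ofReal hhi⟩
  have h7 : ∫⁻ x in L '' S', ENNReal.ofReal (ρh (L.symm x).1) =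
      ∫⁻ q in S', ENNReal.ofReal (ρh q.1) := by
    rw [← hLmp.setLIntegral_comp_emb hemb (fun x ↦ ENNReal.ofReal (ρh (L.symm x).1)) S']
    simp only [L.symm_apply_apply]
  rw [h1, h3, himg, h5]
  constructor
  · calc ENNReal.ofReal ((1 - η) ^ 2) * ∫⁻ q in S', ENNReal.ofReal (ρh q.1)
        = ∫⁻ x in L '' S', ENNReal.ofReal ((1 - η) ^ 2) * ENNReal.ofReal (ρh (L.symm x).1) := by
          rw [← h7, lintegral_const_mul' _ _ ENNReal.ofReal_ne_top]
      _ ≤ ∫⁻ x in L '' S', ENNReal.ofReal |(f' x).det| * ρg (f x) :=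
          setLIntegral_mono' hmLS' fun x hx ↦ (hbound x hx).1
  · calc ∫⁻ x in L '' S', ENNReal.ofReal |(f' x).det| * ρg (f x)
        ≤ ∫⁻ x in L '' S', ENNReal.ofReal ((1 + η) ^ 2) * ENNReal.ofReal (ρh (L.symm x).1) :=
          setLIntegral_mono' hmLS' fun x hx ↦ (hbound x hx).2
      _ = ENNReal.ofReal ((1 + η) ^ 2) * ∫⁻ q in S', ENNReal.ofReal (ρh q.1) := by
          rw [lintegral_const_mul' _ _ ENNReal.ofReal_ne_top, h7]

/-- **Two-sided volume comparison under a transplant** (the `N × ℝ` analogue of the flat case,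
Federer 1969 §3.2.3/§3.2.46): with `g, h, U, Φ, Ψ, η` as in `volume_image_le_and_le_local`
(second countable `M`, `N`), `(1-η)² (V_h ⊗ dt)(S) ≤ Vol_g(Φ S) ≤ (1+η)² (V_h ⊗ dt)(S)` for every
measurable `S ⊆ U`: countable atlases of `N` and `M`, a disjointification of `S` into measurable
pieces each over one chart domain of `N` and mapped into one chart domain of `M`, and countable
additivity on both sides (`Φ` is injective on `U`). [cite: Federer1969, §3.2.3] -/
theorem volume_image_le_and_le [SecondCountableTopology M] [SecondCountableTopology N]
    (g : PseudoRiemannianMetric (𝓡 4) ∞ E4 (TangentSpace (𝓡 4) : M → Type _))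
    (hg : g.IsRiemannian)
    (h : PseudoRiemannianMetric (𝓡 3) ∞ E3 (TangentSpace (𝓡 3) : N → Type _))
    (hh : h.IsRiemannian) {U : Set (N × ℝ)} {Φ : N × ℝ → M} {Ψ : M → N × ℝ} {η : ℝ}
    (h0 : 0 ≤ η) (hη : η < 1) (hU : IsOpen U) (hΦ : ContMDiffOn ((𝓡 3).prod 𝓘(ℝ, ℝ)) (𝓡 4) ∞ Φ U)
    (hΦU : IsOpen (Φ '' U)) (hΨ : ContinuousOn Ψ (Φ '' U)) (hinv : ∀ p ∈ U, Ψ (Φ p) = p)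
    (hD : ∀ p ∈ U, ∀ (v : E3) (s : ℝ), (1 - η) * (h.val p.1 v v + s ^ 2) ≤
        g.val (Φ p) (mfderiv ((𝓡 3).prod 𝓘(ℝ, ℝ)) (𝓡 4) Φ p (v, s))
          (mfderiv ((𝓡 3).prod 𝓘(ℝ, ℝ)) (𝓡 4) Φ p (v, s)) ∧
        g.val (Φ p) (mfderiv ((𝓡 3).prod 𝓘(ℝ, ℝ)) (𝓡 4) Φ p (v, s))
          (mfderiv ((𝓡 3).prod 𝓘(ℝ, ℝ)) (𝓡 4) Φ p (v, s)) ≤ (1 + η) * (h.val p.1 v v + s ^ 2))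
    {S : Set (N × ℝ)} (hSU : S ⊆ U) (hS : MeasurableSet S) :
    ENNReal.ofReal ((1 - η) ^ 2) * (h.riemVolume.prod volume) S ≤ g.riemVolume (Φ '' S) ∧
      g.riemVolume (Φ '' S) ≤ ENNReal.ofReal ((1 + η) ^ 2) * (h.riemVolume.prod volume) S := by
  rcases S.eq_empty_or_nonempty with rfl | ⟨p₁, hp₁⟩
  · simp
  have hΦc : ContinuousOn Φ U := hΦ.continuousOn
  -- countable atlases of `N` and `M`
  obtain ⟨tN, htN, htNc⟩ : ∃ t : Set N, t.Countable ∧ ⋃ x ∈ t, (chartAt E3 x).source = univ :=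
    TopologicalSpace.countable_cover_nhds fun x ↦
      (chartAt E3 x).open_source.mem_nhds (mem_chart_source _ x)
  obtain ⟨tM, htM, htMc⟩ : ∃ t : Set M, t.Countable ∧ ⋃ x ∈ t, (chartAt E4 x).source = univ :=
    TopologicalSpace.countable_cover_nhds fun x ↦
      (chartAt E4 x).open_source.mem_nhds (mem_chart_source _ x)
  have hmemN : ∀ y : N, ∃ x ∈ tN, y ∈ (chartAt E3 x).source := by
    intro y
    have : y ∈ ⋃ x ∈ tN, (chartAt E3 x).source := by rw [htNc]; exact mem_univ y
    simpa only [mem_iUnion, exists_prop] using this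
  have hmemM : ∀ z : M, ∃ x ∈ tM, z ∈ (chartAt E4 x).source := by
    intro z
    have : z ∈ ⋃ x ∈ tM, (chartAt E4 x).source := by rw [htMc]; exact mem_univ z
    simpa only [mem_iUnion, exists_prop] using this
  have htne : (tN ×ˢ tM).Nonempty := by
    obtain ⟨x, hx, -⟩ := hmemN p₁.1
    obtain ⟨x', hx', -⟩ := hmemM (Φ p₁)
    exact ⟨(x, x'), mk_mem_prod hx hx'⟩
  obtain ⟨e, he⟩ := (htN.prod htM).exists_eq_range htne
  -- the open cover `V k` of `S` and the disjoint measurable pieces `T k`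
  set V : ℕ → Set (N × ℝ) := fun k ↦
    (U ∩ (chartAt E3 (e k).1).source ×ˢ (univ : Set ℝ)) ∩ Φ ⁻¹' (chartAt E4 (e k).2).source
    with hV
  have hVo : ∀ k, IsOpen (V k) := fun k ↦
    (hΦc.mono inter_subset_left).isOpen_inter_preimage
      (hU.inter ((chartAt E3 (e k).1).open_source.prod isOpen_univ)) (chartAt E4 (e k).2).open_source
  have hSV : S ⊆ ⋃ k, V k := by
    intro p hp
    obtain ⟨x, hx, hpx⟩ := hmemN p.1
    obtain ⟨x', hx', hpx'⟩ := hmemM (Φ p)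
    have hk : (x, x') ∈ range e := by rw [← he]; exact mk_mem_prod hx hx'
    obtain ⟨k, hk⟩ := hk
    refine mem_iUnion.2 ⟨k, ⟨hSU hp, ?_⟩, ?_⟩
    · rw [hk]; exact ⟨hpx, mem_univ _⟩
    · rw [mem_preimage, hk]; exact hpx'
  set T : ℕ → Set (N × ℝ) := fun k ↦ S ∩ disjointed V k with hT
  have hTm : ∀ k, MeasurableSet (T k) := fun k ↦
    hS.inter (MeasurableSet.disjointed (fun j ↦ (hVo j).measurableSet) k)
  have hTd : Pairwise (Function.onFun Disjoint T) := fun i j hij ↦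
    (disjoint_disjointed V hij).mono inter_subset_right inter_subset_right
  have hTS : ∀ k, T k ⊆ S := fun k ↦ inter_subset_left
  have hTV : ∀ k, T k ⊆ V k := fun k ↦ inter_subset_right.trans (disjointed_subset V k)
  have hST : S = ⋃ k, T k := by
    simp only [hT, ← inter_iUnion, iUnion_disjointed]
    exact (inter_eq_left.2 hSV).symm
  -- both measures decompose along the pieces
  have hvol : (h.riemVolume.prod volume) S = ∑' k, (h.riemVolume.prod volume) (T k) := by
    conv_lhs => rw [hST]
    exact measure_iUnion hTd hTm
  have hinjΦ : InjOn Φ U := fun p hp p' hp' hpp ↦ by rw [← hinv p hp, ← hinv p' hp', hpp]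
  have himm : ∀ k, MeasurableSet (Φ '' T k) := fun k ↦ by
    rw [image_eq_inter_preimage hinv ((hTS k).trans hSU)]
    exact measurableSet_inter_preimage_of_continuousOn hΨ hΦU.measurableSet (hTm k)
  have himd : Pairwise (Function.onFun Disjoint fun k ↦ Φ '' T k) := fun i j hij ↦
    (hTd hij).image hinjΦ ((hTS i).trans hSU) ((hTS j).trans hSU)
  have hμ : g.riemVolume (Φ '' S) = ∑' k, g.riemVolume (Φ '' T k) := by
    conv_lhs => rw [hST, image_iUnion]
    exact measure_iUnion himd himm
  have hk : ∀ k, ENNReal.ofReal ((1 - η) ^ 2) * (h.riemVolume.prod volume) (T k) ≤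
      g.riemVolume (Φ '' T k) ∧
      g.riemVolume (Φ '' T k) ≤ ENNReal.ofReal ((1 + η) ^ 2) * (h.riemVolume.prod volume) (T k) :=
    fun k ↦ volume_image_le_and_le_local g hg h hh h0 hη hU hΦ hΦU hΨ hinv hD (e k).1 (e k).2
      ((hTS k).trans hSU) (hTm k)
      (fun p hp ↦ by
        rw [extChartAt_source]
        exact ⟨((hTV k hp).1.2).1, mem_univ _⟩)
      (fun p hp ↦ (hTV k hp).2)
  constructor
  · rw [hvol, hμ, ← ENNReal.tsum_mul_left]
    exact ENNReal.tsum_le_tsum fun k ↦ (hk k).1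
  · rw [hvol, hμ, ← ENNReal.tsum_mul_left]
    exact ENNReal.tsum_le_tsum fun k ↦ (hk k).2

/-- **Change of variables under a transplant, Lebesgue integrals of nonnegative functions**:
with `g, h, U, Φ, Ψ, η` as in `volume_image_le_and_le`, for every measurable `G ≥ 0` on `N × ℝ`,
`(1-η)² ∫_U G d(V_h ⊗ dt) ≤ ∫_{Φ U} G ∘ Ψ dVol_g ≤ (1+η)² ∫_U G d(V_h ⊗ dt)` (the push-forward
of `Vol_g|_{Φ U}` under `Ψ` is squeezed between `(1∓η)² (V_h ⊗ dt)|_U`). [cite: Federer1969, §3.2.3] -/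
theorem lintegral_comp_le_and_le [SecondCountableTopology M] [SecondCountableTopology N]
    (g : PseudoRiemannianMetric (𝓡 4) ∞ E4 (TangentSpace (𝓡 4) : M → Type _))
    (hg : g.IsRiemannian)
    (h : PseudoRiemannianMetric (𝓡 3) ∞ E3 (TangentSpace (𝓡 3) : N → Type _))
    (hh : h.IsRiemannian) {U : Set (N × ℝ)} {Φ : N × ℝ → M} {Ψ : M → N × ℝ} {η : ℝ}
    (h0 : 0 ≤ η) (hη : η < 1) (hU : IsOpen U) (hΦ : ContMDiffOn ((𝓡 3).prod 𝓘(ℝ, ℝ)) (𝓡 4) ∞ Φ U)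
    (hΦU : IsOpen (Φ '' U)) (hΨ : ContinuousOn Ψ (Φ '' U)) (hinv : ∀ p ∈ U, Ψ (Φ p) = p)
    (hD : ∀ p ∈ U, ∀ (v : E3) (s : ℝ), (1 - η) * (h.val p.1 v v + s ^ 2) ≤
        g.val (Φ p) (mfderiv ((𝓡 3).prod 𝓘(ℝ, ℝ)) (𝓡 4) Φ p (v, s))
          (mfderiv ((𝓡 3).prod 𝓘(ℝ, ℝ)) (𝓡 4) Φ p (v, s)) ∧
        g.val (Φ p) (mfderiv ((𝓡 3).prod 𝓘(ℝ, ℝ)) (𝓡 4) Φ p (v, s))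
          (mfderiv ((𝓡 3).prod 𝓘(ℝ, ℝ)) (𝓡 4) Φ p (v, s)) ≤ (1 + η) * (h.val p.1 v v + s ^ 2))
    {G : N × ℝ → ℝ≥0∞} (hG : Measurable G) :
    ENNReal.ofReal ((1 - η) ^ 2) * ∫⁻ p in U, G p ∂(h.riemVolume.prod volume) ≤
        ∫⁻ x in Φ '' U, G (Ψ x) ∂g.riemVolume ∧
      ∫⁻ x in Φ '' U, G (Ψ x) ∂g.riemVolume ≤
        ENNReal.ofReal ((1 + η) ^ 2) * ∫⁻ p in U, G p ∂(h.riemVolume.prod volume) := by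
  set μ : Measure (N × ℝ) := h.riemVolume.prod volume with hμ
  set ν : Measure (N × ℝ) := (g.riemVolume.restrict (Φ '' U)).map Ψ with hν
  have hΨae : AEMeasurable Ψ (g.riemVolume.restrict (Φ '' U)) :=
    hΨ.aemeasurable hΦU.measurableSet
  have hint : ∫⁻ x in Φ '' U, G (Ψ x) ∂g.riemVolume = ∫⁻ p, G p ∂ν := by
    rw [hν, lintegral_map' hG.aemeasurable hΨae]
  have hνs : ∀ s : Set (N × ℝ), MeasurableSet s → ν s = g.riemVolume (Φ '' (s ∩ U)) := by
    intro s hs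
    rw [hν, Measure.map_apply_of_aemeasurable hΨae hs, Measure.restrict_apply' hΦU.measurableSet,
      image_eq_inter_preimage hinv inter_subset_right, preimage_inter]
    congr 1
    ext x
    simp only [mem_inter_iff, mem_preimage, mem_image]
    constructor
    · rintro ⟨hx, p, hp, rfl⟩
      exact ⟨⟨p, hp, rfl⟩, hx, by rw [hinv p hp]; exact hp⟩
    · rintro ⟨hx, hs', -⟩
      exact ⟨hs', hx⟩
  have hle : ν ≤ ENNReal.ofReal ((1 + η) ^ 2) • μ.restrict U := by
    rw [Measure.le_iff]
    intro s hs
    rw [hνs s hs, Measure.smul_apply, Measure.restrict_apply hs, smul_eq_mul]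
    exact (volume_image_le_and_le g hg h hh h0 hη hU hΦ hΦU hΨ hinv hD inter_subset_right
      (hs.inter hU.measurableSet)).2
  have hge : ENNReal.ofReal ((1 - η) ^ 2) • μ.restrict U ≤ ν := by
    rw [Measure.le_iff]
    intro s hs
    rw [hνs s hs, Measure.smul_apply, Measure.restrict_apply hs, smul_eq_mul]
    exact (volume_image_le_and_le g hg h hh h0 hη hU hΦ hΦU hΨ hinv hD inter_subset_right
      (hs.inter hU.measurableSet)).1
  rw [hint]
  constructor
  · calc ENNReal.ofReal ((1 - η) ^ 2) * ∫⁻ p in U, G p ∂μ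
        = ∫⁻ p, G p ∂(ENNReal.ofReal ((1 - η) ^ 2) • μ.restrict U) := by
          rw [lintegral_smul_measure, smul_eq_mul]
      _ ≤ ∫⁻ p, G p ∂ν := lintegral_mono' hge le_rfl
  · calc ∫⁻ p, G p ∂ν ≤ ∫⁻ p, G p ∂(ENNReal.ofReal ((1 + η) ^ 2) • μ.restrict U) :=
          lintegral_mono' hle le_rfl
      _ = ENNReal.ofReal ((1 + η) ^ 2) * ∫⁻ p in U, G p ∂μ := by
          rw [lintegral_smul_measure, smul_eq_mul]


end VolumeComparison

/-! ### The registered sub-goal of this file -/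

/-- **Registered sub-goal `stub_transplantVolume`** (two-sided volume comparison under a
transplant — the statement of `volume_image_le_and_le` with all binders explicit):
`(1-η)² (V_h ⊗ dt)(S) ≤ Vol_g(Φ S) ≤ (1+η)² (V_h ⊗ dt)(S)` for measurable `S ⊆ U`.
[cite: Federer1969, §3.2.3] -/
theorem stub_transplantVolume : ∀ (M : Type) [TopologicalSpace M] [T2Space M] [SecondCountableTopology M] [ChartedSpace E4 M] [IsManifold (𝓡 4) ∞ M] [T3Space M] [MeasurableSpace M] [BorelSpace M] (N : Type) [TopologicalSpace N] [SecondCountableTopology N] [ChartedSpace E3 N] [IsManifold (𝓡 3) ∞ N] [T3Space N] [MeasurableSpace N] [BorelSpace N] (g : PseudoRiemannianMetric (𝓡 4) ∞ E4 (TangentSpace (𝓡 4) : M → Type _)) (hg : g.IsRiemannian) (h : PseudoRiemannianMetric (𝓡 3) ∞ E3 (TangentSpace (𝓡 3) : N → Type _)) (hh : h.IsRiemannian) (U : Set (N × ℝ)) (Φ : N × ℝ → M) (Ψ : M → N × ℝ) (η : ℝ), 0 ≤ η → η < 1 → IsOpen U → ContMDiffOn ((𝓡 3).prod 𝓘(ℝ,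 ℝ)) (𝓡 4) ∞ Φ U → IsOpen (Φ '' U) → ContinuousOn Ψ (Φ '' U) → (∀ p ∈ U, Ψ (Φ p) = p) → (∀ p ∈ U, ∀ (v : E3) (s : ℝ), (1 - η) * (h.val p.1 v v + s ^ 2) ≤ g.val (Φ p) (mfderiv ((𝓡 3).prod 𝓘(ℝ, ℝ)) (𝓡 4) Φ p (v, s)) (mfderiv ((𝓡 3).prod 𝓘(ℝ, ℝ)) (𝓡 4) Φ p (v, s)) ∧ g.val (Φ p) (mfderiv ((𝓡 3).prod 𝓘(ℝ, ℝ)) (𝓡 4) Φ p (v, s)) (mfderiv ((𝓡 3).prod 𝓘(ℝ, ℝ)) (𝓡 4) Φ p (v, s)) ≤ (1 + η) * (h.val p.1 v v + s ^ 2)) → ∀ S ⊆ U, MeasurableSet S → ENNReal.ofReal ((1 - η) ^ 2) * (h.riemVolume.prod volume) S ≤ g.riemVolume (Φ '' S) ∧ g.riemVolume (Φ '' S) ≤ ENNReal.ofReal ((1 + η) ^ 2) * (h.riemVolume.prod volume) S := by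
  intro M _ _ _ _ _ _ _ _ N _ _ _ _ _ _ _ g hg h hh U Φ Ψ η h0 hη hU hΦ hΦU hΨ hinv hD S hSU hS
  exact volume_image_le_and_le g hg h hh h0 hη hU hΦ hΦU hΨ hinv hD hSU hS

end Summit.SmoothPoincare4.SmoothPoincare4.Theorems.NoncompactShrinkerGapTransplantComparison
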